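import Literature.MathematicalPhysics.QuantumFieldTheory.Balaban1983to89.B8LeafModelZdPerTransfer
import Literature.MathematicalPhysics.QuantumFieldTheory.Balaban1983to89.B8LeafModelZdHP2Per

/-!
# `Balaban1983to89.B8LeafModelZdHP2PerTransfer` — [Balaban1985RegularSpaces] THEOREMS 2 AND 4 PASS FROM THE REPAIRED `ℤᵈ` MEMBER OF RECORD `zdGF3HP₂`
# TO ITS `P`-PERIODIC SUB-MODEL `zdGF3HP₂Per` AT PERIODIC GEOMETRY — «exactly one gauge transformation u» ⇒ `u` is periodic (the device of
# `B8LeafModelZdPerTransfer`, run on the P₂D road's member: (1.37) over print's class `towerBondsP`, (1.36) with the δ₂ Hölder class)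

statement-level skeleton of published theorems with citation tags; proofs where landed; nothing here is a claim about the
Yang–Mills mass gap

PDF held: `paper:balaban1985-cmp99-regular-spaces-gauge-fixing` (journal page = PDF page + 74); pp. 77, 81–83, 86–88.

## WHY THIS FILE (cell `pub-ymgap`, HUMAN RULING D-0062; director-ym №217 (1) (Q2); plan g86 PENS-217; dag-n05-d g14 P4's P3-REQUEST; dag-n05-c g16 LOCATED-MODEL:
the P₂D road of record runs on `zdGF3HP₂` (`Node00/CarriersB8SubBP2D` :71), so the transfers P4 consumes are THESE; count-neutral)

`B8LeafModelZdPerTransfer` proves the device and the per-clause translation covariance of `zdGF3`'s bodies.  The repaired member `zdGF3HP₂` differs in four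
bodies: (1.35)∕(1.66) (`EndBlockIn` class — hypothesis side, no covariance needed), (1.37)∕(1.42) over `towerBondsP L Ω (Λs k) j` (label-periodic at periodic
geometry — displayed as the binder `hΛbP`, a theorem of dag-n05-w2's periodic-towers kit at the (1.5)-members), (1.36)'s Hölder member with BOTH end-points in
`Ω_j` (§1 `c136holderP2_shiftCfg_of_periodic`), and `InR` (hypothesis side).  §2: ★★★ `thm4Printed_hp2per_of_zd`, ★★★ `thm2Printed_hp2per_of_zd` — SAME constants.

## HONEST SCOPE

Bookkeeping ∕ translation covariance + two transfers of EXISTING ℤᵈ member theorems on `zdGF3HP₂` (their sockets unchanged; outer re-key); nothing of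
[Balaban1985RegularSpaces]'s estimates proved; Theorem 8 (surviving form) NOT transferred (its uniqueness clause quantifies over competitors with (1.36)∧(1.39),
granted by its existence clause only in the inspected regime — dag-n05-c LOCATED, pub-ymgap bus).  Count-neutral; N05 NOT discharged; one finite `T⁴`
programme at fixed `ε`; nothing continuum ∕ ℝ⁴ ∕ OS ∕ mass-gap ∕ Clay.  Unit `pub-ymgap-dag-n05-c` (g16), 2026-08-28.  No `sorry`, no `def`, no `instance`, no `notation`.
-/

noncomputable section

open NormedSpace

namespace Literature.MathematicalPhysics.QuantumFieldTheory.Balaban1983to89.B8LeafModelZdHP2PerTransfer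

open B7Prop1Explicit B7Prop2Explicit B7Eq92Concrete
open B7Prop4GeneralLevels (logCovIter)
open B8Ineq132 (covDerivFwd BondTouches)
open B8Eq140Level (SideTouches)
open B8Eq119TwistedAxial (Restr129)
open B8Eq184Proof (cfgExp)
open B8Eq146AExpansion (iEta plaqCovDeriv)
open B8Eq143PlaqExpansion (pdiv)
open B8Eq138LandauZd (IsLandau138 IsLandau138W IsLandau146 IsLandau146W covLap covDivB QT logCfg)
open B8ScaledSupNorm (msup bondNorm)
open B9Eq340HolderZd (hquot AdmPair)
open B8TowerBondsPrinted (towerBondsP)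
open B8LeafModelZd (ZdIdx)
open B8LeafModelZd3 (zdGF3 mlogCfg)
open B8LeafModelZd3P2 (zdGF3HP₂)
open B8LeafModelZdPer (zdGF3Per)
open B8LeafModelZdHP2Per (zdGF3HP₂Per cfgZdH pertZdH gtZdH)
open B8LeafModelZdPerTransfer (sideTouches_add_iff mlogCfg_shiftCfg_of_periodic period_smul_eq_pow_smul restr129_shiftCfg_of_periodic
  c162_shiftCfg_of_periodic c136grad_shiftCfg_of_periodic c137_shiftCfg_of_periodic landauW_shiftCfg_of_periodic c139_shiftCfg_of_periodic
  QT_shiftCfg_of_periodic indicator_shiftCfg_of_periodic)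
open T4TermwiseTorus (IsPeriodic)
open B12Ineq417Flat (shiftCfg shiftCfg_apply)
open B7TranslationCovariance (mgauge_shiftCfg)
open B8TorusShiftStencils (covDerivFwd_shiftCfg covDivB_shiftCfg covLap_shiftCfg logCfg_shiftCfg hquot_shiftCfg admPair_shift_iff msup_shift_univ)

-- `Site` alone could resolve to the torus sites of `Setup.lean`; re-export the `ℤ^d` sites of `B7Prop1Explicit`.
export B7Prop1Explicit (Site)

variable {d : ℕ}

/-! ## §1 The δ₂ Hölder member is translation covariant -/

section Clauses

variable {𝔸 : Type} [CStarAlgebra 𝔸]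

/-- **(1.36)₃ in the δ₂ edition (BOTH end-points of the admissible pair in `Ω_j`) is translation covariant** at `v`-invariant `Ω_j`.
[cite: Balaban1985RegularSpaces, (1.36) p.82, p.86; Balaban1985BackgroundPropagators, (3.40) p.397] -/
theorem c136holderP2_shiftCfg_of_periodic (L k : ℕ) (η β : ℝ) (len : Site d → ℝ) (C : ℝ) {Ω : ℕ → Set (Site d)} {v : Site d}
    (hΩ : ∀ j x, x + v ∈ Ω j ↔ x ∈ Ω j) (U₀ W : Site d → Fin d → 𝔸ˣ)
    (h : msup L k η (-(2 + β)) (fun j (t : Fin d × Fin d × (Site d × Site d)) => t.2.2 ∈ AdmPair η len ∧ t.2.2.1 ∈ Ω j ∧ t.2.2.2 ∈ Ω j)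
      (fun t => hquot η β len U₀ (covDerivFwd η U₀ t.1 (fun z => mlogCfg k η Ω W z t.2.1)) t.2.2) ≤ C) :
    msup L k η (-(2 + β)) (fun j (t : Fin d × Fin d × (Site d × Site d)) => t.2.2 ∈ AdmPair η len ∧ t.2.2.1 ∈ Ω j ∧ t.2.2.2 ∈ Ω j)
      (fun t => hquot η β len (shiftCfg v U₀) (covDerivFwd η (shiftCfg v U₀) t.1 (fun z => mlogCfg k η Ω (shiftCfg v W) z t.2.1)) t.2.2) ≤ C := by
  have hml : mlogCfg k η Ω (shiftCfg v W) = shiftCfg v (mlogCfg k η Ω W) := mlogCfg_shiftCfg_of_periodic k η hΩ W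
  set A : Site d → Fin d → 𝔸 := mlogCfg k η Ω W with hA
  have hF : (fun t : Fin d × Fin d × (Site d × Site d) => hquot η β len (shiftCfg v U₀)
        (covDerivFwd η (shiftCfg v U₀) t.1 (fun z => mlogCfg k η Ω (shiftCfg v W) z t.2.1)) t.2.2)
      = fun t => (fun t' : Fin d × Fin d × (Site d × Site d) => hquot η β len U₀ (covDerivFwd η U₀ t'.1 (fun z => A z t'.2.1)) t'.2.2)
          (t.1, t.2.1, (t.2.2.1 + v, t.2.2.2 + v)) := by
    funext t
    have hD : covDerivFwd η (shiftCfg v U₀) t.1 (fun z => mlogCfg k η Ω (shiftCfg v W) z t.2.1) =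
        shiftCfg v (covDerivFwd η U₀ t.1 (fun z => A z t.2.1)) := by
      funext x
      rw [hml, shiftCfg_apply]
      exact covDerivFwd_shiftCfg η v U₀ t.1 (fun z => A z t.2.1) x
    rw [hD, hquot_shiftCfg]
  rw [hF]
  let σ : (Fin d × Fin d × (Site d × Site d)) ≃ (Fin d × Fin d × (Site d × Site d)) :=
    { toFun := fun t => (t.1, t.2.1, (t.2.2.1 + v, t.2.2.2 + v)), invFun := fun t => (t.1, t.2.1, (t.2.2.1 - v, t.2.2.2 - v)),
      left_inv := fun t => by simp, right_inv := fun t => by simp }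
  have hσ := msup_shift_univ L k η (-(2 + β))
    (fun j (t : Fin d × Fin d × (Site d × Site d)) => t.2.2 ∈ AdmPair η len ∧ t.2.2.1 ∈ Ω j ∧ t.2.2.2 ∈ Ω j) σ
    (fun j t => by
      show (t.2.2 ∈ AdmPair η len ∧ t.2.2.1 ∈ Ω j ∧ t.2.2.2 ∈ Ω j) ↔
        ((t.2.2.1 + v, t.2.2.2 + v) ∈ AdmPair η len ∧ t.2.2.1 + v ∈ Ω j ∧ t.2.2.2 + v ∈ Ω j)
      rw [hΩ j, hΩ j]
      exact and_congr_left' (admPair_shift_iff η len v t.2.2).symm)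
    (fun t' => hquot η β len U₀ (covDerivFwd η U₀ t'.1 (fun z => A z t'.2.1)) t'.2.2)
  exact (le_of_eq hσ).trans h

/-- ★ **(1.146) IN MULTIPLIER FORM IS TRANSLATION COVARIANT IN THE EXPONENT AT PERIODIC DATA** (Theorem 8's Landau equation with source): for `v`-invariant
`Ω₀`, `q_j`-invariant `Λ_j` (`v = Lʲq_j`) and `v`-PERIODIC background `U₀` and source `f`, if `R(U₀)(D^{η*}_{U₀}A − f) = 0 ∧ f ∈ R(U₀)` then the same for `t_vA`
(translated multipliers; the `f ∈ R(U₀)` clause is untouched). [cite: Balaban1985RegularSpaces, (1.146) p.101, (1.38) p.82, p.77; Balaban1985BackgroundPropagators, (3.23)–(3.25) p.394] -/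
theorem isLandau146_shiftCfg_of_periodic {L : ℕ} (hL : 1 ≤ L) (k : ℕ) (η : ℝ) {Ω₀ : Set (Site d)} {Λ : ℕ → Set (Site d)} {q : ℕ → Site d} {v : Site d}
    (hv : ∀ j, j ≤ k → v = ((L : ℤ) ^ j) • q j) (hΩ₀ : ∀ x, x + v ∈ Ω₀ ↔ x ∈ Ω₀) (hΛ : ∀ j, j ≤ k → ∀ y, y + q j ∈ Λ j ↔ y ∈ Λ j)
    {U₀ : Site d → Fin d → 𝔸ˣ} {f : Site d → 𝔸} (hU₀ : shiftCfg v U₀ = U₀) (hf : shiftCfg v f = f) (A : Site d → Fin d → 𝔸)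
    (h : IsLandau146 L k η Ω₀ Λ U₀ f A) : IsLandau146 L k η Ω₀ Λ U₀ f (shiftCfg v A) := by
  obtain ⟨hR, μ, hμ⟩ := h
  refine ⟨hR, fun j => shiftCfg (q j) (μ j), fun x hx => ?_⟩
  have hQT := QT_shiftCfg_of_periodic hL k Λ U₀ μ q v hv hΛ x
  rw [hU₀] at hQT
  rw [hQT, ← hμ (x + v) ((hΩ₀ x).2 hx)]
  have hc : covDivB η U₀ (shiftCfg v A) - f = shiftCfg v (covDivB η U₀ A - f) := by
    funext z
    have h1 := covDivB_shiftCfg η v U₀ A z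
    rw [hU₀] at h1
    have h2 : f z = f (z + v) := by
      have h3 := congrFun hf z
      rw [shiftCfg_apply] at h3
      exact h3.symm
    simp only [Pi.sub_apply, shiftCfg_apply, h1, h2]
  rw [hc, indicator_shiftCfg_of_periodic hΩ₀]
  have h4 := covLap_shiftCfg η v U₀ (Ω₀.indicator (covDivB η U₀ A - f)) x
  rw [hU₀] at h4
  exact h4

/-- ★ **(1.146) FOR A CONFIGURATION (`IsLandau146W`, Theorem 8's Landau gauge with source) IS TRANSLATION COVARIANT at periodic data** — the letter the
«uniqueness ⇒ periodicity» device needs for Theorem 8's core (uniqueness among `Restricted ∧ LandauF ∧ C162` competitors).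
[cite: Balaban1985RegularSpaces, (1.146) p.101, p.77] -/
theorem landauFW_shiftCfg_of_periodic {L : ℕ} (hL : 1 ≤ L) (k : ℕ) (η : ℝ) {Ω₀ : Set (Site d)} {Λ : ℕ → Set (Site d)} {q : ℕ → Site d} {v : Site d}
    (hv : ∀ j, j ≤ k → v = ((L : ℤ) ^ j) • q j) (hΩ₀ : ∀ x, x + v ∈ Ω₀ ↔ x ∈ Ω₀) (hΛ : ∀ j, j ≤ k → ∀ y, y + q j ∈ Λ j ↔ y ∈ Λ j)
    {U₀ : Site d → Fin d → 𝔸ˣ} {f : Site d → 𝔸} (hU₀ : shiftCfg v U₀ = U₀) (hf : shiftCfg v f = f) (W : Site d → Fin d → 𝔸ˣ)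
    (h : IsLandau146W L k η Ω₀ Λ U₀ f W) : IsLandau146W L k η Ω₀ Λ U₀ f (shiftCfg v W) := by
  have h' : IsLandau146 L k η Ω₀ Λ U₀ f (logCfg η W) := h
  have h'' := isLandau146_shiftCfg_of_periodic hL k η hv hΩ₀ hΛ hU₀ hf (logCfg η W) h'
  rw [← logCfg_shiftCfg] at h''
  exact h''

end Clauses

/-! ## §2 THE TRANSFERS: Theorems 4 and 2 pass from the `zdGF3HP₂` family to its periodic sub-model -/

section Transfer

variable {𝔸 : Type} [CStarAlgebra 𝔸] {L : ℕ} {β : ℝ} {len : Site d → ℝ}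

/-- ★★★ **THEOREM 4 TRANSFERS TO THE PERIODIC FAMILY** (same threshold `c₁`, same `B₁′`): along any index map `ι` and period map `p` such that at every
member the domains `Ω_l` are `p j`-periodic, `L^k ∣ p j`, and the top towers `Λs k l` ∕ print's bond classes `towerBondsP L Ω (Λs k) l` (`l ≤ k`) are `(p j ∕ Lˡ)`-periodic in
level-`l` labels, `B8.Thm4Printed B₁′ (zdGF3HP₂ ∘ ι) → B8.Thm4Printed B₁′ (zdGF3HP₂Per ∘ (ι, p))`.  PROOF: hypotheses of the periodic member ARE the ℤᵈ
member's (P1 §3); the ℤᵈ witness `u` is periodic because each translate `t_{P·m}u` satisfies (1.29), (1.37), (1.38), (1.62) for the same periodic data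
(§3–§4 + `mgauge` covariance) and print's «exactly one» identifies it with `u`; uniqueness in the periodic class is the ℤᵈ one.
[cite: Balaban1985RegularSpaces, Thm 4 p.88 («there exists exactly one gauge transformation u»), (1.29) p.81, (1.37)–(1.38) p.82, (1.62) p.87, p.77 («Ω_j ⊂ T_η»)] -/
theorem thm4Printed_hp2per_of_zd (hL : 1 ≤ L) {J : Type} (ι : J → ZdIdx d L) (p : J → ℕ)
    (hΩ : ∀ j l, IsPeriodic (p j) (fun x : Site d => x ∈ (ι j).Ω l))
    (hdvd : ∀ j, L ^ (ι j).k ∣ p j)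
    (hΛs : ∀ j l, l ≤ (ι j).k → IsPeriodic (p j / L ^ l) (fun y : Site d => y ∈ (ι j).Λs (ι j).k l))
    (hΛbP : ∀ j l, l ≤ (ι j).k → ∀ κ : Fin d, IsPeriodic (p j / L ^ l) (fun z : Site d => (z, κ) ∈ towerBondsP L (ι j).Ω ((ι j).Λs (ι j).k) l))
    {B₁' : ℝ} (h : B8.Thm4Printed B₁' (fun j : J => (zdGF3HP₂ 𝔸 L β len (ι j)).toGFData)) :
    B8.Thm4Printed B₁' (fun j : J => (zdGF3HP₂Per 𝔸 L β len (ι j) (p j)).toGFData) := by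
  obtain ⟨c₁, hc₁, H⟩ := h
  refine ⟨c₁, hc₁, fun j α₀ α₁ hα₀ hα₁ hs U₀ Q hInA hReg hInAAx h166 => ?_⟩
  obtain ⟨u, hR, hcl, huniq⟩ := H j α₀ α₁ hα₀ hα₁ hs (cfgZdH U₀) (pertZdH Q) hInA hReg hInAAx h166
  -- abbreviations
  have hΩv : ∀ (m : Site d) (l : ℕ) (y : Site d), y + (((p j : ℕ) : ℤ) • m) ∈ (ι j).Ω l ↔ y ∈ (ι j).Ω l :=
    fun m l y => Iff.of_eq (hΩ j l y m)
  have hvq : ∀ (m : Site d) (l : ℕ), l ≤ (ι j).k → (((p j : ℕ) : ℤ) • m) = ((L : ℤ) ^ l) • ((((p j / L ^ l : ℕ) : ℤ)) • m) :=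
    fun m l hl => period_smul_eq_pow_smul ((pow_dvd_pow L hl).trans (hdvd j)) m
  have hΛsv : ∀ (m : Site d) (l : ℕ), l ≤ (ι j).k → ∀ y, y + (((p j / L ^ l : ℕ) : ℤ)) • m ∈ (ι j).Λs (ι j).k l ↔ y ∈ (ι j).Λs (ι j).k l :=
    fun m l hl y => Iff.of_eq (hΛs j l hl y m)
  have hΛbv : ∀ (m : Site d) (l : ℕ), l ≤ (ι j).k → ∀ (z : Site d) (κ : Fin d),
      (z + (((p j / L ^ l : ℕ) : ℤ)) • m, κ) ∈ towerBondsP L (ι j).Ω ((ι j).Λs (ι j).k) l ↔ (z, κ) ∈ towerBondsP L (ι j).Ω ((ι j).Λs (ι j).k) l :=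
    fun m l hl z κ => Iff.of_eq (hΛbP j l hl κ z m)
  -- the ℤᵈ witness is periodic: «exactly one» + covariance of (1.29), (1.37), (1.38), (1.62)
  have hper : IsPeriodic (p j) u.1 := by
    refine B8LeafModelZdPerTransfer.isPeriodic_of_unique (β := β) (len := len) (hΩ j 0)
      (fun w => (zdGF3HP₂ 𝔸 L β len (ι j)).Restricted (cfgZdH U₀) w ∧
        ((zdGF3HP₂ 𝔸 L β len (ι j)).C137 α₁ (cfgZdH U₀) ((zdGF3HP₂ 𝔸 L β len (ι j)).act (pertZdH Q) w) ∧
          (zdGF3HP₂ 𝔸 L β len (ι j)).Landau (cfgZdH U₀) ((zdGF3HP₂ 𝔸 L β len (ι j)).act (pertZdH Q) w) ∧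
          (zdGF3HP₂ 𝔸 L β len (ι j)).C162 B₁' (α₀ + α₁) (cfgZdH U₀) ((zdGF3HP₂ 𝔸 L β len (ι j)).act (pertZdH Q) w)))
      u (fun u' hu' => huniq u' hu'.1 hu'.2.1 hu'.2.2.1 hu'.2.2.2) (fun m u' hu' => ?_)
    obtain ⟨h137, hLan, h162⟩ := hcl
    -- the clauses for `u`, in concrete form: background `U₀.1`, field `W = (Q.1)^{…}` gauge-fixed by `u`
    set W : Site d → Fin d → 𝔸ˣ := mgauge Q.1.1 u.1⁻¹ Q.2.1 with hW
    have hR' : Restr129 L (ι j).k ((ι j).Λs (ι j).k) U₀.1 u.1 := hR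
    have h137' : ∀ l, l ≤ (ι j).k → ∀ c ∈ towerBondsP L (ι j).Ω ((ι j).Λs (ι j).k) l,
        ‖logCovIter L U₀.1 (iEta (ι j).η (mlogCfg (ι j).k (ι j).η (ι j).Ω W)) l c.1 c.2‖ < 2 * d * L * α₁ := h137
    have hLan' : IsLandau138W L (ι j).k (ι j).η ((ι j).Ω 0) ((ι j).Λs (ι j).k) U₀.1 W := hLan
    have h162' : ∀ l, l ≤ (ι j).k → ∀ b ∈ {b : Site d × Fin d | SideTouches ((ι j).Ω l) b.1 b.2},
        W b.1 b.2 = cfgExp (ι j).η (logCfg (ι j).η W) b.1 b.2 ∧ IsSelfAdjoint (logCfg (ι j).η W b.1 b.2) ∧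
          ‖logCfg (ι j).η W b.1 b.2‖ ≤ B₁' * (α₀ + α₁) * ((L : ℝ) ^ l * (ι j).η)⁻¹ := h162
    -- translate them
    have hRt := restr129_shiftCfg_of_periodic L (ι j).k ((ι j).Λs (ι j).k) U₀.1 u.1 (fun l => (((p j / L ^ l : ℕ) : ℤ)) • m) (((p j : ℕ) : ℤ) • m)
      (hvq m) (hΛsv m) hR'
    have h137t := c137_shiftCfg_of_periodic L (ι j).k (ι j).η (2 * d * L * α₁) (hvq m) (hΩv m) (hΛbv m) U₀.1 W h137'
    have hLant := landauW_shiftCfg_of_periodic hL (ι j).k (ι j).η (hvq m) (hΩv m 0) (hΛsv m) U₀.1 W hLan'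
    have h162t := c162_shiftCfg_of_periodic L (ι j).k (ι j).η (B₁' * (α₀ + α₁)) (hΩv m) W h162'
    -- read back at the ORIGINAL (periodic) data
    have hU₀v : shiftCfg (((p j : ℕ) : ℤ) • m) U₀.1 = U₀.1 := funext fun y => U₀.2.2 y m
    have hQ1v : shiftCfg (((p j : ℕ) : ℤ) • m) Q.1.1 = Q.1.1 := funext fun y => Q.1.2.2 y m
    have hQ2v : shiftCfg (((p j : ℕ) : ℤ) • m) Q.2.1 = Q.2.1 := funext fun y => Q.2.2.2 y m
    have hWt : mgauge Q.1.1 (u'.1)⁻¹ Q.2.1 = shiftCfg (((p j : ℕ) : ℤ) • m) W := by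
      have hm := mgauge_shiftCfg (((p j : ℕ) : ℤ) • m) Q.1.1 u.1⁻¹ Q.2.1
      rw [hQ1v, hQ2v] at hm
      rw [hu']
      exact hm
    rw [hU₀v] at hRt h137t hLant
    rw [← hWt] at h137t hLant h162t
    refine ⟨?_, h137t, hLant, h162t⟩
    show Restr129 L (ι j).k ((ι j).Λs (ι j).k) U₀.1 u'.1
    rw [hu']; exact hRt
  -- the periodic witness
  refine ⟨⟨u.1, u.2, hper⟩, hR, hcl, fun u' hR' h137' hLan' h162' => ?_⟩
  have h := huniq (gtZdH u') hR' h137' hLan' h162'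
  have h1 : u'.1 = u.1 := congrArg Subtype.val h
  exact Subtype.ext h1

/-- ★★★ **THEOREM 2 TRANSFERS TO THE PERIODIC FAMILY** (same `B₁, B₂, c₁`): along `ι, p` as in `thm4Printed_hp2per_of_zd`,
`B8.Thm2Printed (zdGF3HP₂ ∘ ι) → B8.Thm2Printed (zdGF3HP₂Per ∘ (ι, p))` — the ℤᵈ witness is periodic by «exactly one» and the covariance of (1.29),
(1.36)₁₂₃, (1.37), (1.38), (1.39)₁₂ (§3–§4); uniqueness in the periodic class is the ℤᵈ one restricted.
[cite: Balaban1985RegularSpaces, Thm 2 p.83 («there exists exactly one gauge transformation u»), (1.29) p.81, (1.36)–(1.39) pp.82–83, p.77 («Ω_j ⊂ T_η»)] -/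
theorem thm2Printed_hp2per_of_zd (hL : 1 ≤ L) {J : Type} (ι : J → ZdIdx d L) (p : J → ℕ)
    (hΩ : ∀ j l, IsPeriodic (p j) (fun x : Site d => x ∈ (ι j).Ω l))
    (hdvd : ∀ j, L ^ (ι j).k ∣ p j)
    (hΛs : ∀ j l, l ≤ (ι j).k → IsPeriodic (p j / L ^ l) (fun y : Site d => y ∈ (ι j).Λs (ι j).k l))
    (hΛbP : ∀ j l, l ≤ (ι j).k → ∀ κ : Fin d, IsPeriodic (p j / L ^ l) (fun z : Site d => (z, κ) ∈ towerBondsP L (ι j).Ω ((ι j).Λs (ι j).k) l))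
    (h : B8.Thm2Printed (fun j : J => (zdGF3HP₂ 𝔸 L β len (ι j)).toGFData)) :
    B8.Thm2Printed (fun j : J => (zdGF3HP₂Per 𝔸 L β len (ι j) (p j)).toGFData) := by
  obtain ⟨B₁, B₂, c₁, hB₁, hB₂, hc₁, H⟩ := h
  refine ⟨B₁, B₂, c₁, hB₁, hB₂, hc₁, fun j α₀ α₁ hα₀ hα₁ hs U₀ Q hInA hReg hInAAx h135 => ?_⟩
  obtain ⟨u, hR, hcl, huniq⟩ := H j α₀ α₁ hα₀ hα₁ hs (cfgZdH U₀) (pertZdH Q) hInA hReg hInAAx h135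
  have hΩv : ∀ (m : Site d) (l : ℕ) (y : Site d), y + (((p j : ℕ) : ℤ) • m) ∈ (ι j).Ω l ↔ y ∈ (ι j).Ω l :=
    fun m l y => Iff.of_eq (hΩ j l y m)
  have hvq : ∀ (m : Site d) (l : ℕ), l ≤ (ι j).k → (((p j : ℕ) : ℤ) • m) = ((L : ℤ) ^ l) • ((((p j / L ^ l : ℕ) : ℤ)) • m) :=
    fun m l hl => period_smul_eq_pow_smul ((pow_dvd_pow L hl).trans (hdvd j)) m
  have hΛsv : ∀ (m : Site d) (l : ℕ), l ≤ (ι j).k → ∀ y, y + (((p j / L ^ l : ℕ) : ℤ)) • m ∈ (ι j).Λs (ι j).k l ↔ y ∈ (ι j).Λs (ι j).k l :=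
    fun m l hl y => Iff.of_eq (hΛs j l hl y m)
  have hΛbv : ∀ (m : Site d) (l : ℕ), l ≤ (ι j).k → ∀ (z : Site d) (κ : Fin d),
      (z + (((p j / L ^ l : ℕ) : ℤ)) • m, κ) ∈ towerBondsP L (ι j).Ω ((ι j).Λs (ι j).k) l ↔ (z, κ) ∈ towerBondsP L (ι j).Ω ((ι j).Λs (ι j).k) l :=
    fun m l hl z κ => Iff.of_eq (hΛbP j l hl κ z m)
  have hper : IsPeriodic (p j) u.1 := by
    refine B8LeafModelZdPerTransfer.isPeriodic_of_unique (β := β) (len := len) (hΩ j 0)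
      (fun w => (zdGF3HP₂ 𝔸 L β len (ι j)).Restricted (cfgZdH U₀) w ∧
        ((zdGF3HP₂ 𝔸 L β len (ι j)).C136 B₁ B₂ (α₀ + α₁) (cfgZdH U₀) ((zdGF3HP₂ 𝔸 L β len (ι j)).act (pertZdH Q) w) ∧
          (zdGF3HP₂ 𝔸 L β len (ι j)).C137 α₁ (cfgZdH U₀) ((zdGF3HP₂ 𝔸 L β len (ι j)).act (pertZdH Q) w) ∧
          (zdGF3HP₂ 𝔸 L β len (ι j)).Landau (cfgZdH U₀) ((zdGF3HP₂ 𝔸 L β len (ι j)).act (pertZdH Q) w) ∧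
          (zdGF3HP₂ 𝔸 L β len (ι j)).C139 B₁ (α₀ + α₁) (cfgZdH U₀) ((zdGF3HP₂ 𝔸 L β len (ι j)).act (pertZdH Q) w)))
      u (fun u' hu' => huniq u' hu'.1 hu'.2.1 hu'.2.2.1 hu'.2.2.2.1 hu'.2.2.2.2) (fun m u' hu' => ?_)
    obtain ⟨h136, h137, hLan, h139⟩ := hcl
    set W : Site d → Fin d → 𝔸ˣ := mgauge Q.1.1 u.1⁻¹ Q.2.1 with hW
    have hR' : Restr129 L (ι j).k ((ι j).Λs (ι j).k) U₀.1 u.1 := hR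
    have h136' : (∀ l, l ≤ (ι j).k → ∀ b ∈ {b : Site d × Fin d | SideTouches ((ι j).Ω l) b.1 b.2},
          W b.1 b.2 = cfgExp (ι j).η (logCfg (ι j).η W) b.1 b.2 ∧ IsSelfAdjoint (logCfg (ι j).η W b.1 b.2) ∧
            ‖logCfg (ι j).η W b.1 b.2‖ ≤ B₁ * (α₀ + α₁) * ((L : ℝ) ^ l * (ι j).η)⁻¹) ∧
        msup L (ι j).k (ι j).η (-(2 : ℝ)) (fun l (t : Fin d × Fin d × Site d) => SideTouches ((ι j).Ω l) t.2.2 t.2.1)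
            (fun t => covDerivFwd (ι j).η U₀.1 t.1 (fun z => mlogCfg (ι j).k (ι j).η (ι j).Ω W z t.2.1) t.2.2) ≤ B₁ * (α₀ + α₁) ∧
        msup L (ι j).k (ι j).η (-(2 + β)) (fun l (t : Fin d × Fin d × (Site d × Site d)) => t.2.2 ∈ AdmPair (ι j).η len ∧ t.2.2.1 ∈ (ι j).Ω l ∧ t.2.2.2 ∈ (ι j).Ω l)
            (fun t => hquot (ι j).η β len U₀.1 (covDerivFwd (ι j).η U₀.1 t.1 (fun z => mlogCfg (ι j).k (ι j).η (ι j).Ω W z t.2.1)) t.2.2)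
            ≤ B₂ * (α₀ + α₁) := h136
    have h137' : ∀ l, l ≤ (ι j).k → ∀ c ∈ towerBondsP L (ι j).Ω ((ι j).Λs (ι j).k) l,
        ‖logCovIter L U₀.1 (iEta (ι j).η (mlogCfg (ι j).k (ι j).η (ι j).Ω W)) l c.1 c.2‖ < 2 * d * L * α₁ := h137
    have hLan' : IsLandau138W L (ι j).k (ι j).η ((ι j).Ω 0) ((ι j).Λs (ι j).k) U₀.1 W := hLan
    have h139' : bondNorm L (ι j).k (ι j).η (-(3 : ℝ)) (ι j).Ω
          (fun x μ => pdiv (ι j).η U₀.1 (plaqCovDeriv (ι j).η U₀.1 (mlogCfg (ι j).k (ι j).η (ι j).Ω W)) μ x) ≤ B₁ * (α₀ + α₁) ∧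
        bondNorm L (ι j).k (ι j).η (-(3 : ℝ)) (ι j).Ω
          (fun x μ => covLap (ι j).η U₀.1 (fun z => mlogCfg (ι j).k (ι j).η (ι j).Ω W z μ) x) ≤ B₁ * (α₀ + α₁) := h139
    obtain ⟨h136a, h136g, h136h⟩ := h136'
    have hRt := restr129_shiftCfg_of_periodic L (ι j).k ((ι j).Λs (ι j).k) U₀.1 u.1 (fun l => (((p j / L ^ l : ℕ) : ℤ)) • m) (((p j : ℕ) : ℤ) • m)
      (hvq m) (hΛsv m) hR'
    have h136at := c162_shiftCfg_of_periodic L (ι j).k (ι j).η (B₁ * (α₀ + α₁)) (hΩv m) W h136a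
    have h136gt := c136grad_shiftCfg_of_periodic L (ι j).k (ι j).η (B₁ * (α₀ + α₁)) (hΩv m) U₀.1 W h136g
    have h136ht := c136holderP2_shiftCfg_of_periodic L (ι j).k (ι j).η β len (B₂ * (α₀ + α₁)) (hΩv m) U₀.1 W h136h
    have h137t := c137_shiftCfg_of_periodic L (ι j).k (ι j).η (2 * d * L * α₁) (hvq m) (hΩv m) (hΛbv m) U₀.1 W h137'
    have hLant := landauW_shiftCfg_of_periodic hL (ι j).k (ι j).η (hvq m) (hΩv m 0) (hΛsv m) U₀.1 W hLan'
    have h139t := c139_shiftCfg_of_periodic L (ι j).k (ι j).η (B₁ * (α₀ + α₁)) (hΩv m) U₀.1 W h139'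
    have hU₀v : shiftCfg (((p j : ℕ) : ℤ) • m) U₀.1 = U₀.1 := funext fun y => U₀.2.2 y m
    have hQ1v : shiftCfg (((p j : ℕ) : ℤ) • m) Q.1.1 = Q.1.1 := funext fun y => Q.1.2.2 y m
    have hQ2v : shiftCfg (((p j : ℕ) : ℤ) • m) Q.2.1 = Q.2.1 := funext fun y => Q.2.2.2 y m
    have hWt : mgauge Q.1.1 (u'.1)⁻¹ Q.2.1 = shiftCfg (((p j : ℕ) : ℤ) • m) W := by
      have hm := mgauge_shiftCfg (((p j : ℕ) : ℤ) • m) Q.1.1 u.1⁻¹ Q.2.1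
      rw [hQ1v, hQ2v] at hm
      rw [hu']
      exact hm
    rw [hU₀v] at hRt h136gt h136ht h137t hLant h139t
    rw [← hWt] at h136at h136gt h136ht h137t hLant h139t
    refine ⟨?_, ⟨h136at, h136gt, h136ht⟩, h137t, hLant, h139t⟩
    show Restr129 L (ι j).k ((ι j).Λs (ι j).k) U₀.1 u'.1
    rw [hu']; exact hRt
  refine ⟨⟨u.1, u.2, hper⟩, hR, hcl, fun u' hR' h136' h137' hLan' h139' => ?_⟩
  have h := huniq (gtZdH u') hR' h136' h137' hLan' h139'
  have h1 : u'.1 = u.1 := congrArg Subtype.val h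
  exact Subtype.ext h1

end Transfer

end Literature.MathematicalPhysics.QuantumFieldTheory.Balaban1983to89.B8LeafModelZdHP2PerTransfer
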